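import Summits.QuantumAdvantage.AdviceFreeQNC0.WalkGapFibre
import HarnessLib

/-!
# Cell qa-qnc0 (odd primes `p ≥ 5`, rung R3): the fibre GAME and its NAMED LOSING RESIDUE — toolkit II

Planner qa-qnc0-p2 g13, ROUND-13 §1/§4 (`AvoidNormalForm` / `TwoSpeedLoses` in the form the proof of R3 uses).  With
the bits outside a cut-free interval `E = [i, i+L)` fixed (`WalkGapFibre.lean`):

* `GapFibre.F` — the win bit as a function of the ACTIVITY PATTERN `Y = (y_g(ow u z))_g` and the hidden residue
  `t = wt z`: **`ringWinU_ow`**: `ringWinU c y (ow u z) = F(Y(z), wt z)` (`F_mod`: only `t mod 3` matters;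
  `F_congr`: only `Y` on the potentially-active cuts matters);
* **`exists_losing_residue`** (two-speed charge triple): for every pattern some `t ∈ {0,1,2}` LOSES — three odd
  counts cannot sum to `2·#{active}`; `GapFibre.R` = the least such `t`, `namedRes` = `R` of the pattern of `ow u z`;
  **`ringWinU_ow_eq_false_of_hit`**: if the named residue hits `wt z (mod 3)`, the position `ow u z` is LOST;
* degrees: `ind_comp_ow_mem_lowDeg` (restriction to the fibre keeps `HasDegF`), the PATTERN-DEGREE LEMMA
  `ind_mem_lowDeg_of_pattern` (any field: a Boolean function of `|A|` bits of degree `≤ D` has degree `≤ |A|·D`),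
  and **`namedRes_levelSet_mem_lowDeg`**: the three level sets of the naming function have `𝔽_p`-degree `≤ s·D`
  (`s` = number of potentially-active cuts) — exactly the hypothesis of level-set elimination
  (`ElimHardF`/`elimLevelSqrtF`, qn-prover g10's `EliminationHardnessF.lean`).

WHAT THIS IS NOT: the assembly of R3 is `WalkHardFGap.lean`; nothing on the dense crux; separation NOT moved.
-/

noncomputable section

namespace Summit.QuantumAdvantage.AdviceFreeQNC0

open Classical
open Finset
open Literature.Computability.MetaComplexity Literature.Computability.MetaComplexity.Smolensky

variable {n : ℕ}

namespace GapFibre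

/-! ### The fibre game: win bit as a function of (activity pattern, `wt z`) -/

/-- The win bit of the fibre game at charge `c`, activity pattern `Y`, hidden residue `t`. -/
def F (i L c : ℕ) (A : Finset (Fin (n + 1))) (u : Fin n → Bool) (Y : Fin (n + 1) → Bool) (t : ℕ) : Bool :=
  decide ((A.filter fun g : Fin (n + 1) =>
    Y g = true ∧ (kappa i L c u g.val + speed i g.val * t) % 3 ≠ 0).card % 2 = 1)

/-- `F` depends on `t` only modulo `3`. -/
theorem F_mod (i L c : ℕ) (A : Finset (Fin (n + 1))) (u : Fin n → Bool) (Y : Fin (n + 1) → Bool) (t : ℕ) :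
    F i L c A u Y t = F i L c A u Y (t % 3) := by
  unfold F
  have hset : (A.filter fun g : Fin (n + 1) =>
        Y g = true ∧ (kappa i L c u g.val + speed i g.val * t) % 3 ≠ 0) =
      A.filter fun g : Fin (n + 1) =>
        Y g = true ∧ (kappa i L c u g.val + speed i g.val * (t % 3)) % 3 ≠ 0 := by
    refine Finset.filter_congr fun g _ => ?_
    have h : (kappa i L c u g.val + speed i g.val * t) % 3 =
        (kappa i L c u g.val + speed i g.val * (t % 3)) % 3 := by
      unfold speed; split_ifs <;> omega
    rw [h]
  rw [hset]

/-- `F` depends on `Y` only through its values on `A`. -/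
theorem F_congr (i L c : ℕ) (A : Finset (Fin (n + 1))) (u : Fin n → Bool) {Y Y' : Fin (n + 1) → Bool}
    (h : ∀ g ∈ A, Y g = Y' g) (t : ℕ) : F i L c A u Y t = F i L c A u Y' t := by
  unfold F
  have hset : (A.filter fun g : Fin (n + 1) =>
        Y g = true ∧ (kappa i L c u g.val + speed i g.val * t) % 3 ≠ 0) =
      A.filter fun g : Fin (n + 1) =>
        Y' g = true ∧ (kappa i L c u g.val + speed i g.val * t) % 3 ≠ 0 :=
    Finset.filter_congr fun g hg => by rw [h g hg]
  rw [hset]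

/-- **The walk game restricted to a fibre**: for a cut-free interval, the win bit of `ow u z` is the fibre win
bit of the activity pattern of `ow u z` at hidden residue `wt z`. -/
theorem ringWinU_ow {i L : ℕ} (hiL : i + L ≤ n) (c : ℕ) (y : Fin (n + 1) → (Fin n → Bool) → Bool)
    (hcf : CutFree i L y) (u : Fin n → Bool) (z : Fin L → Bool) :
    ringWinU c y (ow i L u z) = F i L c (activeCuts y) u (fun g => y g (ow i L u z)) (wt z) := by
  unfold ringWinU F
  have hset : (univ.filter fun g : Fin (n + 1) =>
      y g (ow i L u z) = true ∧ (c + g.val + walkExp (ow i L u z) g.val) % 3 ≠ 0) =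
      (activeCuts y).filter fun g : Fin (n + 1) =>
        y g (ow i L u z) = true ∧ (kappa i L c u g.val + speed i g.val * wt z) % 3 ≠ 0 := by
    ext g
    simp only [mem_filter, mem_univ, true_and]
    constructor
    · rintro ⟨hy, hne⟩
      have hgA : g ∈ activeCuts y := by
        unfold activeCuts; rw [mem_filter]; exact ⟨mem_univ _, _, hy⟩
      refine ⟨hgA, hy, ?_⟩
      rwa [exponent_ow hiL c u z (hcf g hgA)] at hne
    · rintro ⟨hgA, hy, hne⟩
      refine ⟨hy, ?_⟩
      rwa [exponent_ow hiL c u z (hcf g hgA)]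
  rw [hset]

/-- **Two-speed charge triple**: for every activity pattern some hidden residue loses (three odd counts
would sum to the even number `2·#{active}`). -/
theorem exists_losing_residue (i L c : ℕ) (A : Finset (Fin (n + 1))) (u : Fin n → Bool)
    (Y : Fin (n + 1) → Bool) : ∃ t : ℕ, t < 3 ∧ F i L c A u Y t = false := by
  by_contra hcon
  push Not at hcon
  have hall : ∀ t : ℕ, t < 3 → F i L c A u Y t = true := fun t ht => by
    have := hcon t ht; simpa using this
  -- the three counts
  obtain ⟨N, hN⟩ : ∃ N : ℕ → ℕ, N = fun t => (A.filter fun g : Fin (n + 1) =>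
      Y g = true ∧ (kappa i L c u g.val + speed i g.val * t) % 3 ≠ 0).card := ⟨_, rfl⟩
  have hodd : ∀ t, t < 3 → N t % 2 = 1 := fun t ht => by
    have h := hall t ht
    unfold F at h
    rw [decide_eq_true_eq] at h
    rw [hN]; exact h
  have hNsum : ∀ t, N t = ∑ g ∈ A.filter (fun g : Fin (n + 1) => Y g = true),
      (if (kappa i L c u g.val + speed i g.val * t) % 3 ≠ 0 then 1 else 0 : ℕ) := by
    intro t
    rw [hN, Finset.sum_boole, Finset.filter_filter]
    rfl
  have hthree : ∀ m η : ℕ, (η = 1 ∨ η = 2) →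
      ((if (m + η * 0) % 3 ≠ 0 then 1 else 0 : ℕ) + (if (m + η * 1) % 3 ≠ 0 then 1 else 0 : ℕ) +
        (if (m + η * 2) % 3 ≠ 0 then 1 else 0 : ℕ)) = 2 := by
    intro m η hη
    obtain h | h | h : m % 3 = 0 ∨ m % 3 = 1 ∨ m % 3 = 2 := by omega
    all_goals
      rcases hη with rfl | rfl
      all_goals
        · rw [show (m + _ * 0) % 3 = m % 3 by omega]
          split_ifs <;> omega
  have hsum : N 0 + N 1 + N 2 = 2 * (A.filter fun g : Fin (n + 1) => Y g = true).card := by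
    rw [hNsum 0, hNsum 1, hNsum 2, ← Finset.sum_add_distrib, ← Finset.sum_add_distrib, Finset.card_eq_sum_ones,
      Finset.mul_sum]
    refine Finset.sum_congr rfl fun g _ => ?_
    rw [hthree _ _ (by unfold speed; split_ifs <;> simp), mul_one]
  have h0 := hodd 0 (by norm_num)
  have h1 := hodd 1 (by norm_num)
  have h2 := hodd 2 (by norm_num)
  omega

/-- The NAMED RESIDUE of an activity pattern: a hidden residue at which the fibre game is lost. -/
def R (i L c : ℕ) (A : Finset (Fin (n + 1))) (u : Fin n → Bool) (Y : Fin (n + 1) → Bool) : ℕ :=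
  if F i L c A u Y 0 = false then 0 else if F i L c A u Y 1 = false then 1 else 2

/-- The named residue is one of `0, 1, 2`. -/
theorem R_lt (i L c : ℕ) (A : Finset (Fin (n + 1))) (u : Fin n → Bool) (Y : Fin (n + 1) → Bool) :
    R i L c A u Y < 3 := by
  unfold R; split_ifs <;> norm_num

/-- The named residue loses. -/
theorem F_R (i L c : ℕ) (A : Finset (Fin (n + 1))) (u : Fin n → Bool) (Y : Fin (n + 1) → Bool) :
    F i L c A u Y (R i L c A u Y) = false := by
  unfold R
  by_cases h0 : F i L c A u Y 0 = false
  · rw [if_pos h0]; exact h0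
  · rw [if_neg h0]
    by_cases h1 : F i L c A u Y 1 = false
    · rw [if_pos h1]; exact h1
    · rw [if_neg h1]
      obtain ⟨t, ht, hF⟩ := exists_losing_residue i L c A u Y
      interval_cases t
      · exact absurd hF h0
      · exact absurd hF h1
      · exact hF

/-- `R` depends on `Y` only through its values on `A`. -/
theorem R_congr (i L c : ℕ) (A : Finset (Fin (n + 1))) (u : Fin n → Bool) {Y Y' : Fin (n + 1) → Bool}
    (h : ∀ g ∈ A, Y g = Y' g) : R i L c A u Y = R i L c A u Y' := by
  unfold R
  rw [F_congr i L c A u h 0, F_congr i L c A u h 1]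

/-- The fibre's NAMING FUNCTION: `e_u(z)` = named residue of the activity pattern of `ow u z`. -/
def namedRes (i L c : ℕ) (y : Fin (n + 1) → (Fin n → Bool) → Bool) (u : Fin n → Bool) (z : Fin L → Bool) : ℕ :=
  R i L c (activeCuts y) u (fun g => y g (ow i L u z))

/-- **A hit of the named residue is a loss**: if `e_u(z) ≡ wt z (mod 3)` then `ow u z` is lost. -/
theorem ringWinU_ow_eq_false_of_hit {i L : ℕ} (hiL : i + L ≤ n) (c : ℕ)
    (y : Fin (n + 1) → (Fin n → Bool) → Bool) (hcf : CutFree i L y) (u : Fin n → Bool) (z : Fin L → Bool)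
    (hhit : namedRes i L c y u z % 3 = wt z % 3) : ringWinU c y (ow i L u z) = false := by
  rw [ringWinU_ow hiL c y hcf u z, F_mod, ← hhit]
  unfold namedRes
  rw [Nat.mod_eq_of_lt (R_lt _ _ _ _ _ _)]
  exact F_R _ _ _ _ _ _

/-! ### Degrees in the fibre -/

section Degree

variable {p : ℕ} [Fact p.Prime]

/-- Restriction to the fibre keeps the degree: the coordinates of `z ↦ ow u z` are constants or variables. -/
theorem ind_comp_ow_mem_lowDeg {i L D : ℕ} (u : Fin n → Bool) {f : (Fin n → Bool) → Bool}
    (hf : HasDegF p f D) :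
    (fun z : Fin L → Bool => if f (ow i L u z) = true then (1 : ZMod p) else 0) ∈ lowDeg (ZMod p) L D := by
  unfold HasDegF at hf
  refine comp_mem_lowDeg_of_coord (F := ZMod p) (ow i L u) (fun b => ?_) hf
  by_cases h : i ≤ b.val ∧ b.val < i + L
  · have heq : (fun z : Fin L → Bool => if ow i L u z b = true then (1 : ZMod p) else 0) =
        fun z => if z ⟨b.val - i, by omega⟩ then (1 : ZMod p) else 0 := by
      funext z; rw [ow_of_inE u z h]
    rw [heq]
    exact bitFn_mem_lowDeg _ le_rfl
  · have heq : (fun z : Fin L → Bool => if ow i L u z b = true then (1 : ZMod p) else 0) =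
        fun _ => if u b = true then (1 : ZMod p) else 0 := by
      funext z; rw [ow_of_not_inE u z h]
    rw [heq]
    by_cases hub : u b = true
    · rw [show (fun _ : Fin L → Bool => if u b = true then (1 : ZMod p) else 0) = 1 from by
        funext z; rw [if_pos hub]; rfl]
      exact one_mem_lowDeg 1
    · rw [show (fun _ : Fin L → Bool => if u b = true then (1 : ZMod p) else 0) = 0 from by
        funext z; rw [if_neg hub]; rfl]
      exact Submodule.zero_mem _

/-- **Pattern-degree lemma** (any field): if `f z` depends only on the bits `(h g z)_{g ∈ A}` and each `h g`
has an indicator of degree `≤ D`, then `f` has an indicator of degree `≤ |A|·D`. -/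
theorem ind_mem_lowDeg_of_pattern {F : Type*} [Field F] {L D : ℕ} {ι : Type*} (A : Finset ι)
    (h : ι → (Fin L → Bool) → Bool)
    (hh : ∀ g ∈ A, (fun z => if h g z = true then (1 : F) else 0) ∈ lowDeg F L D)
    (f : (Fin L → Bool) → Bool) (hf : ∀ z z', (∀ g ∈ A, h g z = h g z') → f z = f z') :
    (fun z => if f z = true then (1 : F) else 0) ∈ lowDeg F L (A.card * D) := by
  -- pattern factors
  have hfac : ∀ g ∈ A, ∀ b : Bool,
      (fun z : Fin L → Bool => if h g z = b then (1 : F) else 0) ∈ lowDeg F L D := by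
    intro g hg b
    cases b
    · have heq : (fun z : Fin L → Bool => if h g z = false then (1 : F) else 0) =
          1 - fun z => if h g z = true then (1 : F) else 0 := by
        funext z
        by_cases hz : h g z = true
        · simp [hz]
        · simp [hz]
      rw [heq]
      exact Submodule.sub_mem _ (one_mem_lowDeg D) (hh g hg)
    · exact hh g hg
  -- agreement with a pattern `Y ⊆ A`
  have hagree : ∀ Y : Finset ι,
      (fun z : Fin L → Bool => if (∀ g ∈ A, h g z = decide (g ∈ Y)) then (1 : F) else 0) ∈
        lowDeg F L (A.card * D) := by
    intro Y
    have heq : (fun z : Fin L → Bool => if (∀ g ∈ A, h g z = decide (g ∈ Y)) then (1 : F) else 0) =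
        ∏ g ∈ A, (fun z : Fin L → Bool => if h g z = decide (g ∈ Y) then (1 : F) else 0) := by
      funext z
      rw [Finset.prod_apply]
      by_cases hz : ∀ g ∈ A, h g z = decide (g ∈ Y)
      · rw [if_pos hz]
        exact (Finset.prod_eq_one fun g hg => by rw [if_pos (hz g hg)]).symm
      · rw [if_neg hz]
        push Not at hz
        obtain ⟨g, hg, hne⟩ := hz
        exact (Finset.prod_eq_zero hg (by rw [if_neg hne])).symm
    rw [heq]
    exact prod_mem_lowDeg A (fun g hg => hfac g hg _)
  -- expansion over realised true patterns
  obtain ⟨P, hP⟩ : ∃ P : Finset (Finset ι), P = A.powerset.filter fun Y =>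
    ∃ z : Fin L → Bool, (∀ g ∈ A, h g z = decide (g ∈ Y)) ∧ f z = true := ⟨_, rfl⟩
  have hPmem : ∀ Y : Finset ι, Y ∈ P ↔
      Y ⊆ A ∧ ∃ z : Fin L → Bool, (∀ g ∈ A, h g z = decide (g ∈ Y)) ∧ f z = true := fun Y => by
    rw [hP, mem_filter, Finset.mem_powerset]
  have heq : (fun z => if f z = true then (1 : F) else 0) =
      ∑ Y ∈ P, fun z : Fin L → Bool => if (∀ g ∈ A, h g z = decide (g ∈ Y)) then (1 : F) else 0 := by
    funext z
    rw [Finset.sum_apply]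
    -- the pattern of `z`
    obtain ⟨Y₀, hY₀⟩ : ∃ Y₀ : Finset ι, Y₀ = A.filter fun g => h g z = true := ⟨_, rfl⟩
    have hz₀ : ∀ g ∈ A, h g z = decide (g ∈ Y₀) := by
      intro g hg
      rw [hY₀]
      by_cases hgz : h g z = true
      · rw [hgz]; symm; rw [decide_eq_true_eq, mem_filter]; exact ⟨hg, hgz⟩
      · have hgz' : h g z = false := by simpa using hgz
        rw [hgz']; symm; rw [decide_eq_false_iff_not, mem_filter]; exact fun hm => hgz hm.2
    have huniq : ∀ Y ∈ P, (∀ g ∈ A, h g z = decide (g ∈ Y)) → Y = Y₀ := by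
      intro Y hY hpat
      have hYA : Y ⊆ A := ((hPmem Y).1 hY).1
      ext g
      constructor
      · intro hgY
        have hgA := hYA hgY
        have := hpat g hgA
        rw [hz₀ g hgA] at this
        have : decide (g ∈ Y₀) = true := by rw [this]; exact decide_eq_true hgY
        exact of_decide_eq_true this
      · intro hgY₀
        have hgA : g ∈ A := by rw [hY₀] at hgY₀; exact (Finset.mem_filter.1 hgY₀).1
        have := hpat g hgA
        rw [hz₀ g hgA, decide_eq_true hgY₀] at this
        exact of_decide_eq_true this.symm
    by_cases hfz : f z = true
    · rw [if_pos hfz]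
      have hY₀P : Y₀ ∈ P := by
        rw [hPmem]
        exact ⟨by rw [hY₀]; exact Finset.filter_subset _ _, z, hz₀, hfz⟩
      rw [← Finset.add_sum_erase P _ hY₀P, if_pos hz₀, Finset.sum_eq_zero (fun Y hY => ?_), add_zero]
      rw [Finset.mem_erase] at hY
      rw [if_neg (fun hpat => hY.1 (huniq Y hY.2 hpat))]
    · rw [if_neg hfz]
      refine (Finset.sum_eq_zero fun Y hY => ?_).symm
      rw [if_neg]
      intro hpat
      obtain ⟨_, z', hz', hfz'⟩ := (hPmem Y).1 hY
      have : f z = f z' := hf z z' (fun g hg => by rw [hpat g hg, hz' g hg])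
      rw [this] at hfz
      exact hfz hfz'
  rw [heq]
  exact Submodule.sum_mem _ fun Y _ => hagree Y

/-- **The level sets of the naming function have `𝔽_p`-degree `≤ s·D`** (`s` = number of potentially-active
cuts, `D` = degree of the selections). -/
theorem namedRes_levelSet_mem_lowDeg {i L c D : ℕ} (y : Fin (n + 1) → (Fin n → Bool) → Bool)
    (hdeg : ∀ g, HasDegF p (y g) D) (u : Fin n → Bool) (r : ℕ) :
    (fun z : Fin L → Bool => if namedRes i L c y u z % 3 = r % 3 then (1 : ZMod p) else 0) ∈
      lowDeg (ZMod p) L ((activeCuts y).card * D) := by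
  have h := ind_mem_lowDeg_of_pattern (F := ZMod p) (activeCuts y) (fun g z => y g (ow i L u z))
    (fun g _ => ind_comp_ow_mem_lowDeg u (hdeg g))
    (fun z => decide (namedRes i L c y u z % 3 = r % 3))
    (fun z z' hzz' => by
      unfold namedRes
      rw [R_congr i L c (activeCuts y) u (Y := fun g => y g (ow i L u z))
        (Y' := fun g => y g (ow i L u z')) hzz'])
  refine (congrArg (· ∈ lowDeg (ZMod p) L ((activeCuts y).card * D)) ?_).mpr h
  funext z
  simp only [decide_eq_true_eq]

end Degree

end GapFibre

end Summit.QuantumAdvantage.AdviceFreeQNC0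

end
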